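import Summits.Schanuel.Schanuel.Theorems.DiophantineDichotomyDefs
import Summits.Schanuel.Schanuel.Theorems.DiophantineDichotomyKhovanskiiApproxTypeSiegelInIdeal
import Summits.Schanuel.Schanuel.Theorems.DiophantineDichotomyKhovanskiiApproxTypeTransferOfSiegel
import Summits.Schanuel.Schanuel.Theorems.DiophantineDichotomyKhovanskiiApproxTypeSlotDichotomyTwo

/-!
# Line `lw-small-height` — crux `DiophantineDichotomy.KhovanskiiApproxType` (stmt-Schanuel-6116)
# Skeleton v3 (line lead `prover-line-stmt-Schanuel-6116-r-0`, re-seated 2026-08-16)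

The vocabulary (`IsFreeKhovanskii`, `ApproxTypeAt`, `mvNatHeight`, `CodimOneMeasure`, `SlotFloor`,
`PrimitiveApproxMeasure`) and the stub statements (`LWSmallHeight m`, `CodimOneTransfer`,
`SlotDichotomyTwo`, `NonLWInputsTwo`, `RankThreeUp`, and — new in v2 — `SiegelInIdealShape`,
`SiegelInIdeal`) live in the accepted definitions module
`Summits/Schanuel/Schanuel/Theorems/DiophantineDichotomyDefs.lean` (p72431, p73726) and are imported,
not re-declared, so that the stub files `Theorems/DiophantineDichotomyKhovanskiiApproxType<Stub>.lean`
(each `theorem stub_… : <Statement>` in this namespace, landed `--supports stmt-Schanuel-6116`) and this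
closing skeleton share ONE copy of every object.

**The line** (planner `planner-cruxplan-stmt-Schanuel-6116-lw-small-height-0`, card
`Cruxes/KhovanskiiApproxType/Lines/lw-small-height.md`): at a free Khovanskii point
`θ = (s, e^s) ∈ ℂ⁴` (`n = 2`) a decoupled codimension-one measure `C⁺ (μ)` at a pair of coordinates,
floors `(A)` at both, the TRANSFER "Siegel inside the ideal of the challenger" (`CodimOneMeasure ⇒
PrimitiveApproxMeasure`, `p = (μ+1)/2`) and the SLOT DICHOTOMY give approximation type
`a = A·p/(A+1) < 1`; on the Lindemann–Weierstrass layer (`s ∈ ℚ̄²`) the inputs are the small-height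
LW measures `LWSmallHeight 2` (`C⁺`, `μ = 2`) and `LWSmallHeight 1` (floors, `A = 1`), giving
`a = 3/4`.  `n ≥ 3` is the residual stub `RankThreeUp` (= the crux there; architecture cap
`(n+1)/(2n) ≥ 1/(n−1)`).

**v2 reshape.** `stub_codimOneTransfer : CodimOneTransfer` (v1) is split into
`stub_siegelInIdeal : SiegelInIdeal` (box principle in one complex embedding + archimedean Liouville
inequality ⇒ a non-zero `Q ∈ ℤ[X]` on the monomial box `eᵢ ≤ t`, `(t+1)^m ≥ A([ℚ(γ):ℚ]+1)`, with
`Q(γ) = 0`, `log H(Q) ≤ log B + E log(t+1) + E·t·Σ h(γⱼ)`) and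
`stub_transferOfSiegel : SiegelInIdeal → CodimOneTransfer` (irreducible integer factor = minimal
polynomial, `h(γⱼ) = log M(fⱼ)/deg fⱼ ≤ (log H + ½log(d+1))/d'`, `C⁺` at `Q`, mean value
`|Q(ω)| ≤ N·H(Q)·mt·R^{mt}·‖ω − γ‖`).  Seven registered stubs (= stubs_max):
`stub_lwSmallHeight_one`, `stub_lwSmallHeight_two` (open: the card's research content),
`stub_siegelInIdeal`, `stub_transferOfSiegel`, `stub_slotDichotomy_two` (provable now: the spine),
`stub_nonLWInputs_two` (open, Schanuel-strength), `stub_rankThreeUp` (residual = crux for `n ≥ 3`).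
Composition (sorry-free): `codimOneTransfer_holds`, `approxTypeAt_two_of_LW`,
`khovanskiiApproxType_of_parts`, `KhovanskiiApproxType_of` (concludes the crux BY NAME).

**v3 (wave 1 integrated).** The spine has LANDED: `stub_siegelInIdeal` (p76390, with helper module
`…SiegelBox`, p75708), `stub_transferOfSiegel` (p76504, with `…TransferOfSiegelLemmas`, p75356) and
`stub_slotDichotomy_two` (p75181) are theorems of the tree (modules imported above) and no longer carry a
`sorry` here; `CodimOneTransfer` is therefore a THEOREM (`codimOneTransfer_holds`).  Remaining sorries =
the four OPEN stubs `stub_lwSmallHeight_one`, `stub_lwSmallHeight_two`, `stub_nonLWInputs_two`,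
`stub_rankThreeUp`; the LW layer `approxTypeAt_two_of_LW` is closed modulo the two LW stubs only.

Disproof used (`Cruxes/KhovanskiiApproxType/Disproof.lean`, cdisprove cycle 1): no kill; load-bearing
`khovanskiiApproxType_false_without_linIndep` / `_false_from_one` (Diaz beats every `a < 1` along one
transcendental slot) — consistent: every exponent produced here uses two slots (`a = A p/(A+1)` with
`A ≥ 1`, `p ≥ 3/2` forced by Dirichlet, so `a ≥ 3/4 ≥ 1/2` = route-review floor `1/n`); tightness
`not_khovanskiiApproxTypeUniform` — consistent: all constants here depend on the point; `-- Targets`: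
none yet.
-/

noncomputable section

set_option linter.dupNamespace false

open scoped BigOperators

namespace Summit.Schanuel.Schanuel.Cruxes.KhovanskiiApproxType.LwSmallHeight

open Summit.Schanuel.Schanuel.Theses.DiophantineDichotomy (KhovanskiiApproxType)

/-! ## Registered stubs -/

/-- STUB 1 (size L–XL, OPEN; the floor at every `e^{algebraic}` slot): small-height
Lindemann–Weierstrass in ONE variable — for algebraic `β ≠ 0`,
`log|P(e^β)| ≥ −C(deg P · log H(P) + (deg P)^K)` for all non-zero `P ∈ ℤ[X]` and ALL heights.
In print only `A = 2` decoupled (`e^β` has type `3 + ε`, Chudnovsky), `A = 1` only for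
`log log H ≫ d² log d` (Popken–Mahler; Bugeaud 2004 p. 83). -/
theorem stub_lwSmallHeight_one : LWSmallHeight 1 := by
  sorry

/-- STUB 2 (size XL, OPEN; the card's hardest own target): small-height Lindemann–Weierstrass in TWO
variables, `log|P(e^{y₁}, e^{y₂})| ≥ −C((deg P)² log H(P) + (deg P)^K)`, all heights (in print only
with the penalty `exp(C D² log(D+1))` in place of `D^K`: Ably 1994). -/
theorem stub_lwSmallHeight_two : LWSmallHeight 2 := by
  sorry

/-! STUBS 3a, 3b, 4 — LANDED (wave 1): `stub_siegelInIdeal : SiegelInIdeal` (p76390),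
`stub_transferOfSiegel : SiegelInIdeal → CodimOneTransfer` (p76504),
`stub_slotDichotomy_two : SlotDichotomyTwo` (p75181), imported from their Theorems modules. -/

/-- STUB 5 (size XL, OPEN, Schanuel-strength pointwise): `C⁺ (μ)` + floors `(A)` with
`A(μ+1) < 2(A+1)` at every `n = 2` free Khovanskii point off the LW layer (contains `e ⊥ π` with a
measure at `s = (1, iπ)`). -/
theorem stub_nonLWInputs_two : NonLWInputsTwo := by
  sorry

/-- STUB 6 (residual, OPEN; = the crux for `n ≥ 3`, not attacked by this line). -/
theorem stub_rankThreeUp : RankThreeUp := by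
  sorry

/-! ## Composition (sorry-free) -/

/-- **The transfer is a theorem of the tree** (wave 1): `CodimOneTransfer` — a decoupled
codimension-one measure `(μ, K)` at `ω ∈ ℂᵐ` gives the primitive approximation measure with
`p = (μ+1)/m`, `q = (max μ K + 1)/m + 1` — from the landed halves `stub_siegelInIdeal` (relative Siegel
lemma, box principle + Liouville) and `stub_transferOfSiegel` (Mahler–Weil heights + mean value). -/
theorem codimOneTransfer_holds : CodimOneTransfer :=
  stub_transferOfSiegel stub_siegelInIdeal

/-- **The Lindemann–Weierstrass layer**: at `s ∈ ℚ̄²` with `ℚ`-linearly independent coordinates,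
`LWSmallHeight 2` is `C⁺` with `μ = 2` at the pair of `y`-slots `(e^{s₁}, e^{s₂})`, `LWSmallHeight 1`
gives the floors with `A = 1` there, the transfer gives `p = 3/2`, and the slot dichotomy gives
approximation type `a < 1` (the bookkeeping gives `a = 3/4`). -/
theorem approxTypeAt_two_of_LW (h₁ : LWSmallHeight 1) (h₂ : LWSmallHeight 2)
    (hT : CodimOneTransfer) (hD : SlotDichotomyTwo) (s : Fin 2 → ℂ)
    (halg : ∀ i, IsAlgebraic ℚ (s i)) (hli : LinearIndependent ℚ s) :
    ∃ a b C : ℝ, a < 1 ∧ ApproxTypeAt 2 s a b C := by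
  -- `C⁺` on the LW layer: the two-variable small-height LW measure at `(e^{s₁}, e^{s₂})`
  obtain ⟨K, C, hK, hC⟩ := h₂ s halg hli
  -- the transfer: primitive approximation measure with `p = (2+1)/2`
  obtain ⟨C', hP⟩ := hT 2 (Complex.exp ∘ s) ((2 : ℕ) : ℝ) K C (by norm_num) (by positivity) hK hC
  -- the floors at the two `y`-slots: the one-variable small-height LW measure at `e^{s i}`
  have hfloors : ∀ i : Fin 2, ∃ K₁ C₁ : ℝ,
      SlotFloor (Sum.elim s (Complex.exp ∘ s) (Sum.inr i)) ((1 : ℕ) : ℝ) K₁ C₁ := by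
    intro i
    have hli1 : LinearIndependent ℚ (fun _ : Fin 1 => s i) :=
      linearIndependent_unique_iff.2 (hli.ne_zero i)
    obtain ⟨K₁, C₁, -, h⟩ := h₁ (fun _ => s i) (fun _ => halg i) hli1
    exact ⟨K₁, C₁, h⟩
  -- the slot dichotomy with `A = 1`, `p = 3/2`: `A p = 3/2 < 2 = A + 1`
  exact hD s Sum.inr _ _ C' ((1 : ℕ) : ℝ) Sum.inr_injective (by positivity) (by norm_num)
    (by norm_num) hP hfloors

/-- **Composition of the line**, pointwise form: `n ≥ 3` is the residual stub; at `n = 2` the LW layer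
is `approxTypeAt_two_of_LW`, and off the LW layer the inputs stub feeds the same transfer + slot
dichotomy with `p = (μ+1)/2`. -/
theorem khovanskiiApproxType_of_parts (h₁ : LWSmallHeight 1) (h₂ : LWSmallHeight 2)
    (hT : CodimOneTransfer) (hD : SlotDichotomyTwo) (hN : NonLWInputsTwo) (hR : RankThreeUp) :
    ∀ (n : ℕ) (s : Fin n → ℂ), 2 ≤ n → LinearIndependent ℚ s → IsFreeKhovanskii n s →
      ∃ a b C : ℝ, a < 1 / ((n : ℝ) - 1) ∧ ApproxTypeAt n s a b C := by
  intro n s hn hli hfree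
  by_cases h3 : 3 ≤ n
  · exact hR n s h3 hli hfree
  obtain rfl : n = 2 := by omega
  have key : ∃ a b C : ℝ, a < 1 ∧ ApproxTypeAt 2 s a b C := by
    by_cases halg : ∀ i, IsAlgebraic ℚ (s i)
    · exact approxTypeAt_two_of_LW h₁ h₂ hT hD s halg hli
    · push Not at halg
      obtain ⟨i, hi⟩ := halg
      obtain ⟨e, he, μ, K, C, A, hμ, hK, hA, hrace, hC, hfl⟩ := hN s hli hfree ⟨i, hi⟩
      obtain ⟨C', hP⟩ := hT 2 _ μ K C (by norm_num) hμ hK hC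
      have hp : (0 : ℝ) ≤ (μ + 1) / (2 : ℕ) := by positivity
      have hrace' : A * ((μ + 1) / (2 : ℕ)) < A + 1 := by
        push_cast
        nlinarith [hrace, hA]
      exact hD s e _ _ C' A he hp hA hrace' hP hfl
  obtain ⟨a, b, C, ha, hat⟩ := key
  refine ⟨a, b, C, ?_, hat⟩
  have h1 : (1 : ℝ) / (((2 : ℕ) : ℝ) - 1) = 1 := by norm_num
  rw [h1]
  exact ha

/-- **The skeleton concludes the crux BY NAME.** `KhovanskiiApproxType` (route `DiophantineDichotomy`,
stmt-Schanuel-6116) from the registered stubs (three landed, four open). -/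
theorem KhovanskiiApproxType_of : KhovanskiiApproxType :=
  khovanskiiApproxType_iff.2
    (khovanskiiApproxType_of_parts stub_lwSmallHeight_one stub_lwSmallHeight_two
      codimOneTransfer_holds stub_slotDichotomy_two stub_nonLWInputs_two stub_rankThreeUp)

end Summit.Schanuel.Schanuel.Cruxes.KhovanskiiApproxType.LwSmallHeight

end
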